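import Mathlib
import Literature.Analysis.FluidPDE.TypeIICoreWitness
import Summits.NavierStokesRegularity.NavierStokesRegularity.Theorems.TypeIIInviscidRelaxationCoreExclusionAnchorReduction
import HarnessLib

/-!
# Crux `MonopoleCoreExclusion` (stmt-1965): the anchor stub `stub_anchoredLateAxisymWitness` REDUCED to
# late axisymmetric witnesses with a core-radius floor

`--supports stmt-NavierStokesRegularity-1965` (helper file; theorems only, no definitions, no `sorry`).  The
class-generic reduction `CoreExclusionAnchor.anchoredLateWitness_of_lateWitnesses_radiusFloor`
(`TypeIIInviscidRelaxationCoreExclusionAnchorReduction`) specialised to the axisymmetric class `IsAxisymmetric`,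
which is stable under dilations (`isAxisymmetric_dilate`: rotations about the axis are linear).  In the binder
shape of the registered stub of line `axisymmetric_comparison_flow`: replacing the crux hypothesis `hw` by LATE
axisymmetric witnesses with a CORE-RADIUS FLOOR (`hwl`) yields the stub's conclusion verbatim (singular anchor `xs`,
anchored late level-`K` axisymmetric witnesses for every `K > 0`).  What remains research for the stub: lateness
`(T-t)V ≤ KL` with a floor `r₀ ≤ KL` (the reduction does not use the crux's conditional hypothesis
`AxisymSwirlRegular`).

Consequently the line's composition runs for the LATE-FLOOR form of the crux with ONLY the shadowing stub open:
`monopoleCoreExclusion_lateFloor_of_shadowing` — given the conclusion of the LANDED transfer stub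
`AxisymComparisonFlow.stub_axisymComparisonFlowOfAX hAX` (p830344/p830482; hypothesis `hComp`, verbatim — kept as a
hypothesis so that this file stays outside the import cone of the route file, in which that stub's hypothesis
`AxisymSwirlRegular` lives) and the statement of the registered stub `stub_axisymShadowing` (hypothesis `hShadow`,
verbatim), no maximal smooth Leray–Hopf solution from a decaying datum carries late axisymmetric witnesses with a
core-radius floor (`¬ IsTypeIBlowup` is not needed).  Nothing about Navier–Stokes regularity is claimed; the crux
`MonopoleCoreExclusion` itself (hypothesis `hw`, no lateness) is NOT proved.
-/

noncomputable section

open Set Metric MeasureTheory Function Filter Topology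
open Literature.Analysis Literature.Analysis.FluidPDE
open scoped ENNReal

namespace Summit.NavierStokesRegularity.NavierStokesRegularity.Theorems

-- the problem directory repeats the summit name (`NavierStokesRegularity/NavierStokesRegularity`)
set_option linter.dupNamespace false

namespace CoreExclusionAnchor

/-- Axisymmetric profiles are stable under dilations `W ↦ W(c·)` (rotations about the axis are linear).
[folklore] -/
theorem isAxisymmetric_dilate {W : EuclideanSpace ℝ (Fin 3) → EuclideanSpace ℝ (Fin 3)}
    (hW : IsAxisymmetric W) (c : ℝ) : IsAxisymmetric (fun y => W (c • y)) := by
  have rotZ_smul : ∀ (θ a : ℝ) (y : EuclideanSpace ℝ (Fin 3)), rotZ θ (a • y) = a • rotZ θ y :=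
    fun θ a y => by
      ext i
      fin_cases i <;> simp <;> ring
  intro θ y
  simp only [← rotZ_smul, hW θ (c • y)]

/-- **Crux `MonopoleCoreExclusion` (stmt-1965), anchor stub reduced.**  In the binder shape of the registered stub
`stub_anchoredLateAxisymWitness` (line `axisymmetric_comparison_flow`): if the axisymmetric witnesses of the crux
can be taken LATE with a CORE-RADIUS FLOOR, the stub's conclusion holds verbatim. [folklore] -/
theorem anchoredLateAxisymWitness_of_lateWitnesses_radiusFloor {ν T : ℝ}
    {u : ℝ → EuclideanSpace ℝ (Fin 3) → EuclideanSpace ℝ (Fin 3)}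
    {p : ℝ → EuclideanSpace ℝ (Fin 3) → ℝ}
    (hν : 0 < ν) (hT : 0 < T) (hmax : IsMaximalSmoothSolution ν 0 u p T)
    (hLH : IsLerayHopfOn T ν 0 (u 0) u) (hdec : HasRapidSpatialDecay (u 0))
    (hwl : ∃ r₀ : ℝ, 0 < r₀ ∧ ∀ K : ℝ, 0 < K → ∀ t₀ < T, ∃ t, t₀ < t ∧ t < T ∧
      ∃ (x₀ : EuclideanSpace ℝ (Fin 3)) (L V : ℝ)
        (Q : EuclideanSpace ℝ (Fin 3) ≃ₗᵢ[ℝ] EuclideanSpace ℝ (Fin 3))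
        (W : EuclideanSpace ℝ (Fin 3) → EuclideanSpace ℝ (Fin 3)),
        0 < L ∧ 0 < V ∧ IsAxisymmetric W ∧ (∀ x, ‖u t x‖ ≤ V) ∧
        (∃ x₁, dist x₁ x₀ ≤ L ∧ V ≤ 2 * ‖u t x₁‖) ∧
        (∃ y y' : EuclideanSpace ℝ (Fin 3), ‖y‖ ≤ 1 ∧ ‖y'‖ ≤ 1 ∧ (4 : ℝ)⁻¹ ≤ ‖W y - W y'‖) ∧
        K * ν ≤ L * V ∧
        (∀ y : EuclideanSpace ℝ (Fin 3), ‖y‖ ≤ K →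
          ‖V⁻¹ • Q.symm (u t (x₀ + L • Q y)) - W y‖ ≤ K⁻¹) ∧
        (T - t) * V ≤ K * L ∧ r₀ ≤ K * L) :
    ∃ xs : EuclideanSpace ℝ (Fin 3),
      (¬ ∃ ρ M : ℝ, 0 < ρ ∧ ∀ s ∈ Ioo (T - ρ ^ 2) T, ∀ x ∈ ball xs ρ, ‖u s x‖ ≤ M) ∧
      ∀ K : ℝ, 0 < K → ∃ t : ℝ, 0 < t ∧ t < T ∧
        ∃ (x₀ : EuclideanSpace ℝ (Fin 3)) (L V : ℝ)
          (Q : EuclideanSpace ℝ (Fin 3) ≃ₗᵢ[ℝ] EuclideanSpace ℝ (Fin 3))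
          (W : EuclideanSpace ℝ (Fin 3) → EuclideanSpace ℝ (Fin 3)),
          0 < L ∧ 0 < V ∧ IsAxisymmetric W ∧ (∀ x, ‖u t x‖ ≤ V) ∧
          (∃ x₁, dist x₁ x₀ ≤ L ∧ V ≤ 2 * ‖u t x₁‖) ∧
          (∃ y y' : EuclideanSpace ℝ (Fin 3), ‖y‖ ≤ 1 ∧ ‖y'‖ ≤ 1 ∧ (4 : ℝ)⁻¹ ≤ ‖W y - W y'‖) ∧
          K * ν ≤ L * V ∧
          (∀ y : EuclideanSpace ℝ (Fin 3), ‖y‖ ≤ K →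
            ‖V⁻¹ • Q.symm (u t (x₀ + L • Q y)) - W y‖ ≤ K⁻¹) ∧
          (T - t) * V ≤ K * L ∧ dist xs x₀ ≤ K * L / 4 :=
  anchoredLateWitness_of_lateWitnesses_radiusFloor (C := IsAxisymmetric)
    (fun _ hW c _ => isAxisymmetric_dilate hW c) hν hT hmax hLH hdec hwl

/-- **The late-floor form of crux `MonopoleCoreExclusion` follows from the shadowing stub alone (given the transfer).**
Assume the conclusion of the landed transfer stub `AxisymComparisonFlow.stub_axisymComparisonFlowOfAX hAX` (hypothesis
`hComp`, verbatim: a bounded exactly axisymmetric comparison flow `A·V/K`-close on `B(x₀, KL)` from every level-`K ≥ 1`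
axisymmetric core datum) and the statement of the registered stub `stub_axisymShadowing` (hypothesis `hShadow`,
verbatim).  Then no maximal smooth solution on `[0,T)`, Leray–Hopf from a rapidly decaying datum, carries LATE
axisymmetric core witnesses with a core-radius floor at every level frequently before `T`: the anchor reduction gives a
singular point `xs` and an anchored late level-`K₀` witness, `hComp` the comparison flow, `hShadow` a bound on
`[t,T) × B(x₀, K₀L/2)` ⊇ `(T-ρ²,T) × B_ρ(xs)`, `ρ = min (K₀L/4) √(T-t)` — contradiction. [folklore] -/
theorem monopoleCoreExclusion_lateFloor_of_shadowing
    (hComp : ∃ A : ℝ, 0 < A ∧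
      ∀ (ν T t K : ℝ) (u : ℝ → EuclideanSpace ℝ (Fin 3) → EuclideanSpace ℝ (Fin 3))
        (p : ℝ → EuclideanSpace ℝ (Fin 3) → ℝ),
        0 < ν → 0 < T → IsClassicalNSSolutionOn (Ico 0 T) ν 0 u p → IsLerayHopfOn T ν 0 (u 0) u →
        HasRapidSpatialDecay (u 0) → 0 < t → t < T → 1 ≤ K →
        ∀ (x₀ : EuclideanSpace ℝ (Fin 3)) (L V : ℝ)
          (Q : EuclideanSpace ℝ (Fin 3) ≃ₗᵢ[ℝ] EuclideanSpace ℝ (Fin 3))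
          (W : EuclideanSpace ℝ (Fin 3) → EuclideanSpace ℝ (Fin 3)),
          0 < L → 0 < V → IsAxisymmetric W → (∀ x, ‖u t x‖ ≤ V) → K * ν ≤ L * V →
          (∀ y : EuclideanSpace ℝ (Fin 3), ‖y‖ ≤ K →
            ‖V⁻¹ • Q.symm (u t (x₀ + L • Q y)) - W y‖ ≤ K⁻¹) →
          ∃ (v : ℝ → EuclideanSpace ℝ (Fin 3) → EuclideanSpace ℝ (Fin 3))
            (q : ℝ → EuclideanSpace ℝ (Fin 3) → ℝ) (Mv : ℝ),
            IsClassicalNSSolutionOn (Icc t T) ν 0 v q ∧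
            (∀ s ∈ Icc t T, IsAxisymmetric (fun y : EuclideanSpace ℝ (Fin 3) => Q.symm (v s (x₀ + Q y)))) ∧
            (∀ s ∈ Icc t T, ∀ x, ‖v s x‖ ≤ Mv) ∧
            (∀ x ∈ ball x₀ (K * L), ‖u t x - v t x‖ ≤ A * V / K))
    (hShadow : ∀ A : ℝ, 0 < A → ∃ K₀ : ℝ, 1 ≤ K₀ ∧ ∀ K : ℝ, K₀ ≤ K →
      ∀ (ν T t : ℝ) (u : ℝ → EuclideanSpace ℝ (Fin 3) → EuclideanSpace ℝ (Fin 3))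
        (p : ℝ → EuclideanSpace ℝ (Fin 3) → ℝ),
        0 < ν → 0 < T → IsClassicalNSSolutionOn (Ico 0 T) ν 0 u p → IsLerayHopfOn T ν 0 (u 0) u →
        HasRapidSpatialDecay (u 0) → 0 < t → t < T →
        ∀ (x₀ : EuclideanSpace ℝ (Fin 3)) (L V : ℝ)
          (Q : EuclideanSpace ℝ (Fin 3) ≃ₗᵢ[ℝ] EuclideanSpace ℝ (Fin 3)),
          0 < L → 0 < V → (∀ x, ‖u t x‖ ≤ V) →
          (∃ x₁, dist x₁ x₀ ≤ L ∧ V ≤ 2 * ‖u t x₁‖) → K * ν ≤ L * V → (T - t) * V ≤ K * L →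
          ∀ (v : ℝ → EuclideanSpace ℝ (Fin 3) → EuclideanSpace ℝ (Fin 3))
            (q : ℝ → EuclideanSpace ℝ (Fin 3) → ℝ) (Mv : ℝ),
            IsClassicalNSSolutionOn (Icc t T) ν 0 v q →
            (∀ s ∈ Icc t T, IsAxisymmetric (fun y : EuclideanSpace ℝ (Fin 3) => Q.symm (v s (x₀ + Q y)))) →
            (∀ s ∈ Icc t T, ∀ x, ‖v s x‖ ≤ Mv) →
            (∀ x ∈ ball x₀ (K * L), ‖u t x - v t x‖ ≤ A * V / K) →
            ∃ M : ℝ, ∀ s ∈ Ico t T, ∀ x ∈ ball x₀ (K * L / 2), ‖u s x‖ ≤ M)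
    {ν T : ℝ} {u : ℝ → EuclideanSpace ℝ (Fin 3) → EuclideanSpace ℝ (Fin 3)}
    {p : ℝ → EuclideanSpace ℝ (Fin 3) → ℝ}
    (hν : 0 < ν) (hT : 0 < T) (hmax : IsMaximalSmoothSolution ν 0 u p T)
    (hLH : IsLerayHopfOn T ν 0 (u 0) u) (hdec : HasRapidSpatialDecay (u 0))
    (hwl : ∃ r₀ : ℝ, 0 < r₀ ∧ ∀ K : ℝ, 0 < K → ∀ t₀ < T, ∃ t, t₀ < t ∧ t < T ∧
      ∃ (x₀ : EuclideanSpace ℝ (Fin 3)) (L V : ℝ)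
        (Q : EuclideanSpace ℝ (Fin 3) ≃ₗᵢ[ℝ] EuclideanSpace ℝ (Fin 3))
        (W : EuclideanSpace ℝ (Fin 3) → EuclideanSpace ℝ (Fin 3)),
        0 < L ∧ 0 < V ∧ IsAxisymmetric W ∧ (∀ x, ‖u t x‖ ≤ V) ∧
        (∃ x₁, dist x₁ x₀ ≤ L ∧ V ≤ 2 * ‖u t x₁‖) ∧
        (∃ y y' : EuclideanSpace ℝ (Fin 3), ‖y‖ ≤ 1 ∧ ‖y'‖ ≤ 1 ∧ (4 : ℝ)⁻¹ ≤ ‖W y - W y'‖) ∧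
        K * ν ≤ L * V ∧
        (∀ y : EuclideanSpace ℝ (Fin 3), ‖y‖ ≤ K →
          ‖V⁻¹ • Q.symm (u t (x₀ + L • Q y)) - W y‖ ≤ K⁻¹) ∧
        (T - t) * V ≤ K * L ∧ r₀ ≤ K * L) :
    False := by
  obtain ⟨A, hA, hcomp⟩ := hComp
  obtain ⟨K₀, hK₀1, hstab⟩ := hShadow A hA
  have hK₀ : 0 < K₀ := lt_of_lt_of_le one_pos hK₀1
  obtain ⟨xs, hsing, hcov⟩ :=
    anchoredLateAxisymWitness_of_lateWitnesses_radiusFloor hν hT hmax hLH hdec hwl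
  obtain ⟨t, ht0, htT, x₀, L, V, Q, W, hL, hV, hax, hbd, hnear, hosc, hRe, hclose, hlate, hdist⟩ :=
    hcov K₀ hK₀
  obtain ⟨v, q, Mv, hv, hvax, hvbd, hvclose⟩ :=
    hcomp ν T t K₀ u p hν hT hmax.1 hLH hdec ht0 htT hK₀1 x₀ L V Q W hL hV hax hbd hRe hclose
  obtain ⟨M, hM⟩ := hstab K₀ le_rfl ν T t u p hν hT hmax.1 hLH hdec ht0 htT x₀ L V Q hL hV hbd hnear
    hRe hlate v q Mv hv hvax hvbd hvclose
  apply hsing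
  have hTt : 0 < T - t := sub_pos.2 htT
  set ρ : ℝ := min (K₀ * L / 4) (Real.sqrt (T - t)) with hρ
  have hρpos : 0 < ρ := lt_min (by positivity) (Real.sqrt_pos.2 hTt)
  have hρsq : ρ ^ 2 ≤ T - t :=
    calc ρ ^ 2 ≤ (Real.sqrt (T - t)) ^ 2 := pow_le_pow_left₀ hρpos.le (min_le_right _ _) 2
      _ = T - t := Real.sq_sqrt hTt.le
  have hρle : ρ ≤ K₀ * L / 4 := min_le_left _ _
  refine ⟨ρ, M, hρpos, fun s hs x hx => hM s ⟨?_, hs.2⟩ x ?_⟩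
  · linarith [hs.1]
  · rw [mem_ball] at hx ⊢
    calc dist x x₀ ≤ dist x xs + dist xs x₀ := dist_triangle _ _ _
      _ < ρ + K₀ * L / 4 := by linarith
      _ ≤ K₀ * L / 4 + K₀ * L / 4 := by linarith
      _ = K₀ * L / 2 := by ring

end CoreExclusionAnchor

end Summit.NavierStokesRegularity.NavierStokesRegularity.Theorems

end
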